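import Literature.MathematicalPhysics.QuantumFieldTheory.ConstructiveQFTWave0
import HarnessLib

/-!
# The time-slice (transfer) kernel of Wilson's lattice gauge theory; trace excess of a cold torus

Definitions only (Osterwalder–Seiler 1978 §§2–3; Lüscher, Commun. Math. Phys. 54 (1977) 283; Seiler,
LNP 159, Ch. 2).  Slicing the torus `(ℤ/N)⁴` across the time direction `0`, the links of one time slice
are a THREE-dimensional gauge configuration `GaugeConfig 3 N G` (spatial links; their plaquette energy is
`wilsonAction (d := 3)`), plus the temporal links `Site 3 N → G` based at the slice.  We define
* `sliceTemporalAction ρ U g U'` — the energy `Σ_{x⃗, i} (n − Re tr ρ(g_x U'_{x,i} g_{x+eᵢ}⁻¹ U_{x,i}⁻¹))` of the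
  temporal plaquettes between consecutive slices `U, U'` with temporal links `g`
  (cf. `plaquetteHolonomy U x 0 i = U(x,0) U(x+e₀,i) U(x+eᵢ,0)⁻¹ U(x,i)⁻¹`);
* `wilsonSliceKernel ρ β N U U' := e^{−β S₃(U)/2} (∫ e^{−β S_tm(U, g, U')} ∏_x dg_x) e^{−β S₃(U')/2}` — the one-step
  kernel with the temporal links integrated against Haar (the Gauss-law projection); it is symmetric,
  bounded by `1` for `β ≥ 0`, continuous and strictly positive for continuous `ρ`, and positive definite
  (`exp(β Re tr ρ(·))` is a positive-definite function on `G`), so that its `L²` integral operator — the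
  TRANSFER OPERATOR — is compact, self-adjoint and `≥ 0` (tree: `Literature/Analysis/OperatorTheory/
  PositiveKernelTransferOperator`);
* `cyclicPartition ρ β N m := ∫ ∏_{t : ZMod m} K_β(U_t, U_{t+1}) ∏_t dU_t` — the partition function of the
  ASYMMETRIC torus `m × N³` (for `m = N` it is `partitionFunction (d := 4)` up to reindexing the edges by time
  — a theorem left to the users, as is every spectral statement);
* `transferSpectralRadius ρ β N := limsup_m Z_β((m+1) × N³)^{1/(m+1)}` (`= λ₊`, the top eigenvalue);
* `traceExcess ρ β N m := Z_β(m × N³)/λ₊^m − 1` (`= Σ_{i ≥ 1} (λᵢ/λ₊)^m = tr T̂ᵐ − 1` for `m ≥ 2`: the thermal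
  multiplicity of the cold torus — the free-energy currency in which card `trace-norm-cold-pressure` of crux
  `WeakCouplingHypercubicLimit` states the infrared clause: "the Wilson partition function of a cold torus
  does not feel its period").
Deliberately NOT here: the transfer operator itself (delivered by `exists_transferOperator` of the toolkit),
the identification with `partitionFunction`/`wilsonMeasure` expectations, positivity and spectral facts.
-/

noncomputable section

open MeasureTheory Filter

namespace Literature.MathematicalPhysics.QuantumFieldTheory

variable {N n : ℕ} [NeZero N] {G : Type*} [Group G] (ρ : G →* Matrix (Fin n) (Fin n) ℂ)

/-- **Temporal plaquette energy** between a time slice `U : GaugeConfig 3 N G` (spatial links), its temporal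
links `g : Site 3 N → G` and the next slice `U'`: `Σ_{x⃗} Σ_{i : Fin 3} (n − Re tr ρ(g_x U'_{x,i} g_{x+eᵢ}⁻¹ U_{x,i}⁻¹))`
— the plaquettes in the `(0, i)` planes, written as in `plaquetteHolonomy` with `U((t,x⃗),0) = g_x`. [cite: Wilson1974] -/
def sliceTemporalAction (U : GaugeConfig 3 N G) (g : Site 3 N → G) (U' : GaugeConfig 3 N G) : ℝ :=
  ∑ x : Site 3 N, ∑ i : Fin 3, ((n : ℝ) - (ρ (g x * U' (x, i) * (g (x.shift i))⁻¹ * (U (x, i))⁻¹)).trace.re)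

variable [TopologicalSpace G] [IsTopologicalGroup G] [CompactSpace G] [MeasurableSpace G] [BorelSpace G]

/-- **The Wilson time-slice (transfer) kernel**, temporal links integrated out:
`K_β(U, U') = e^{−β S₃(U)/2} (∫ e^{−β S_tm(U, g, U')} ∏_x dHaar(g_x)) e^{−β S₃(U')/2}`, `S₃ = wilsonAction (d := 3)` the
spatial plaquette energy of a slice (split half-and-half between the two bonds meeting at the slice). [cite: OsterwalderSeiler1978, §2] -/
def wilsonSliceKernel (β : ℝ) (U U' : GaugeConfig 3 N G) : ℝ :=
  Real.exp (-(β * wilsonAction ρ U / 2)) *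
    (∫ g, Real.exp (-(β * sliceTemporalAction ρ U g U')) ∂(Measure.pi fun _ : Site 3 N => haarProbability G)) *
    Real.exp (-(β * wilsonAction ρ U' / 2))

/-- **Partition function of the asymmetric torus** `m × N³`: the cyclic integral of `m` slice kernels,
`Z_β(m × N³) = ∫ ∏_{t : ZMod m} K_β(U_t, U_{t+1}) ∏_t dU_t`, `dU_t` the product Haar measure on the spatial links
of a slice. [cite: OsterwalderSeiler1978, §2] -/
def cyclicPartition (β : ℝ) (N m : ℕ) [NeZero N] [NeZero m] : ℝ :=
  ∫ V : ZMod m → GaugeConfig 3 N G, ∏ t : ZMod m, wilsonSliceKernel ρ β (V t) (V (t + 1))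
    ∂(Measure.pi fun _ : ZMod m => Measure.pi fun _ : Edge 3 N => haarProbability G)

/-- **Principal growth rate** `λ₊(β, N) := limsup_{m → ∞} Z_β((m+1) × N³)^{1/(m+1)}` — the top eigenvalue (operator
norm) of the transfer operator of `wilsonSliceKernel`. [cite: OsterwalderSeiler1978, §3] -/
def transferSpectralRadius (β : ℝ) (N : ℕ) [NeZero N] : ℝ :=
  limsup (fun m : ℕ => (cyclicPartition ρ β N (m + 1)) ^ (((m : ℝ) + 1)⁻¹)) atTop

/-- **Trace excess of the cold torus** `m × N³`: `X_{β,N}(m) := Z_β(m × N³)/λ₊(β,N)^m − 1`, the thermal multiplicity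
`Σ_{i ≥ 1} (λᵢ/λ₊)^m = tr T̂ᵐ − 1` of the normalised transfer semigroup (junk value `−1` when `λ₊ = 0`, which does not
happen for continuous `ρ` and `β ≥ 0`). [cite: OsterwalderSeiler1978, §3] -/
def traceExcess (β : ℝ) (N m : ℕ) [NeZero N] [NeZero m] : ℝ :=
  cyclicPartition ρ β N m / transferSpectralRadius ρ β N ^ m - 1

end Literature.MathematicalPhysics.QuantumFieldTheory

end
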